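import Summits.SmoothPoincare4.SmoothPoincare4.Theorems.CongruenceShadowsHeegaardHandlebodyCongruenceClosedReduction
import Summits.SmoothPoincare4.SmoothPoincare4.Theorems.CongruenceShadowsHeegaardHandlebodyCongruenceClosedStubPairShadowFiniteQuotients
import Summits.SmoothPoincare4.SmoothPoincare4.Theorems.CongruenceShadowsHeegaardHandlebodyCongruenceClosedStubProfiniteFreenessDetection

/-!
# Anatomy of a fine ghost — crux `CongruenceShadows.HeegaardHandlebodyCongruenceClosed`
(item stmt-SmoothPoincare4-14596, line `pair-rigidity-retraction`; `--supports` the crux via the registered stub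
`stub_ghostAnatomy`)

Notation as in `…Reduction.lean`: `S = SurfaceGroup (3+3m)`, `N = s4Kernels.stabilizeIter m = (N₀,N₁,N₂)`, product-congruent
`ρ ∈ Aut S` = the crux hypothesis, `T_ρ = (N₀, N₁, ρN₂)`, `J_ρ = N₀ ⊔ N₁ ⊔ ρN₂`, `G_ρ = S ⧸ J_ρ` (the glued group).

Modulo the three existing route items the crux is the statement "no fine ghosts" (`…Equivalence.lean`): every
product-congruent `ρ` has `G_ρ = 1`.  This file records what a counterexample would have to be.

* `isGroupTrisection_twisted_self` — as soon as the two twisted pair quotients `S ⧸ ⟪N_i ∪ ρN₂⟫` (`i = 0,1`) are free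
  of rank `m+1`, the twisted triple `T_ρ` is a `(3+3m; m+1)` group trisection (Abrams–Gay–Kirby) of ITS OWN glued group,
  i.e. of `T_ρ.tripleQuotient` — with no hypothesis on `G_ρ`.
* `ghostAnatomy_of_item` (= registered stub `stub_ghostAnatomy`) — under the route item `HeegaardPairFreenessDetection`
  (stmt-15157) this applies to EVERY product-congruent `ρ` (pair freeness from P1 + 15157).
* `nonempty_tripleQuotient_twisted_equiv` — `T_ρ.tripleQuotient ≃* S ⧸ J_ρ`, connecting with the landed dichotomy
  (`stub_limitsSimplyConnectedDichotomy`: `J_ρ = ⊤`, or `S ⧸ J_ρ` is infinite with no non-trivial finite quotient).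
* `ghost_dichotomy_of_item` — the two together: for a product-congruent `ρ`, `T_ρ` is a balanced group trisection of a
  group `G` which is either trivial or infinite without non-trivial finite quotients.  By AGK Thm 5 (for general `G`) a
  fine ghost is thus a `(3+3m; m+1)`-trisected closed 4-manifold with perfect, profinitely trivial, non-trivial `π₁` —
  an integral homology 4-sphere of Kervaire–Higman type whose gluing lies in the fine congruence closure of the product
  set.  Known such spheres (double of the Higman 2-complex thickening) need `k = m+1 ≥ 4` one-handles.
-/

noncomputable section

-- the prescribed namespace `Summit.<P>.<Sub>.…` duplicates `SmoothPoincare4` (P = Sub)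
set_option linter.dupNamespace false

namespace Summit.SmoothPoincare4.SmoothPoincare4.Theorems.HeegaardHandlebodyCongruenceClosed.PairRigidityRetraction

open Literature.Topology.FourManifolds Subgroup
open Summit.SmoothPoincare4.SmoothPoincare4.Theses.CongruenceShadows (HeegaardPairFreenessDetection)
open Summit.SmoothPoincare4.SmoothPoincare4.Theorems.WaldhausenPairs.Negative (stabilizeIter_isGroupTrisection)

/-! ## The twisted triple is a group trisection of its own glued group -/

/-- **`T_ρ = (N₀, N₁, ρN₂)` is a `(3+3m; m+1)` group trisection of its own triple quotient** as soon as the two twisted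
pair quotients `S ⧸ ⟪N₀ ∪ ρN₂⟫`, `S ⧸ ⟪N₁ ∪ ρN₂⟫` are free of rank `m+1` (normality and the single quotients come from the
standard triple transported along `ρ`; the `(0,1)` pair is standard; the triple condition is `refl`). [folklore] -/
theorem isGroupTrisection_twisted_self {m : ℕ} {ρ : SurfaceGroup (3 + 3 * m) ≃* SurfaceGroup (3 + 3 * m)}
    (h0 : IsFreeOfRank (SurfaceGroup (3 + 3 * m) ⧸ normalClosure
      ((s4Kernels.stabilizeIter m 0 : Set (SurfaceGroup (3 + 3 * m))) ∪
        ((s4Kernels.stabilizeIter m 2).map ρ.toMonoidHom : Subgroup (SurfaceGroup (3 + 3 * m))))) (m + 1))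
    (h1 : IsFreeOfRank (SurfaceGroup (3 + 3 * m) ⧸ normalClosure
      ((s4Kernels.stabilizeIter m 1 : Set (SurfaceGroup (3 + 3 * m))) ∪
        ((s4Kernels.stabilizeIter m 2).map ρ.toMonoidHom : Subgroup (SurfaceGroup (3 + 3 * m))))) (m + 1)) :
    IsGroupTrisection (3 + 3 * m) (m + 1)
      (TrisectionKernels.tripleQuotient
        (![s4Kernels.stabilizeIter m 0, s4Kernels.stabilizeIter m 1, (s4Kernels.stabilizeIter m 2).map ρ.toMonoidHom] :
          TrisectionKernels (3 + 3 * m)))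
      (![s4Kernels.stabilizeIter m 0, s4Kernels.stabilizeIter m 1, (s4Kernels.stabilizeIter m 2).map ρ.toMonoidHom] :
        TrisectionKernels (3 + 3 * m)) := by
  set K : TrisectionKernels (3 + 3 * m) :=
    ![s4Kernels.stabilizeIter m 0, s4Kernels.stabilizeIter m 1, (s4Kernels.stabilizeIter m 2).map ρ.toMonoidHom] with hK
  have hN := stabilizeIter_isGroupTrisection m
  haveI h2n : (s4Kernels.stabilizeIter m 2).Normal := stabilizeIter_normal m 2
  have h02 : IsFreeOfRank (K.pairQuotient 0 2) (m + 1) := h0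
  have h12 : IsFreeOfRank (K.pairQuotient 1 2) (m + 1) := h1
  have symm : ∀ i j : Fin 3, IsFreeOfRank (K.pairQuotient i j) (m + 1) → IsFreeOfRank (K.pairQuotient j i) (m + 1) :=
    fun i j h => h.of_mulEquiv (QuotientGroup.quotientMulEquivOfEq (by rw [Set.union_comm]))
  refine ⟨?_, ?_, ?_, ⟨MulEquiv.refl _⟩⟩
  · intro i
    fin_cases i
    · exact hN.normal 0
    · exact hN.normal 1
    · exact map_stabilizeIter_normal m 2 ρ
  · intro i
    fin_cases i
    · exact hN.free_quotient 0
    · exact hN.free_quotient 1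
    · have h2 := hN.free_quotient 2
      change IsFreeOfRank (SurfaceGroup (3 + 3 * m) ⧸ normalClosure
        (((s4Kernels.stabilizeIter m 2).map ρ.toMonoidHom : Subgroup (SurfaceGroup (3 + 3 * m))) :
          Set (SurfaceGroup (3 + 3 * m)))) (3 + 3 * m)
      have e₁ : SurfaceGroup (3 + 3 * m) ⧸ normalClosure ((s4Kernels.stabilizeIter m 2 :
          Subgroup (SurfaceGroup (3 + 3 * m))) : Set (SurfaceGroup (3 + 3 * m))) ≃*
          SurfaceGroup (3 + 3 * m) ⧸ s4Kernels.stabilizeIter m 2 :=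
        QuotientGroup.quotientMulEquivOfEq (normalClosure_eq_self _)
      haveI : ((s4Kernels.stabilizeIter m 2).map ρ.toMonoidHom).Normal := map_stabilizeIter_normal m 2 ρ
      have e₂ : SurfaceGroup (3 + 3 * m) ⧸ s4Kernels.stabilizeIter m 2 ≃*
          SurfaceGroup (3 + 3 * m) ⧸ (s4Kernels.stabilizeIter m 2).map ρ.toMonoidHom :=
        QuotientGroup.congr (s4Kernels.stabilizeIter m 2) ((s4Kernels.stabilizeIter m 2).map ρ.toMonoidHom) ρ rfl
      have e₃ : SurfaceGroup (3 + 3 * m) ⧸ (s4Kernels.stabilizeIter m 2).map ρ.toMonoidHom ≃*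
          SurfaceGroup (3 + 3 * m) ⧸ normalClosure (((s4Kernels.stabilizeIter m 2).map ρ.toMonoidHom :
            Subgroup (SurfaceGroup (3 + 3 * m))) : Set (SurfaceGroup (3 + 3 * m))) :=
        QuotientGroup.quotientMulEquivOfEq (normalClosure_eq_self _).symm
      exact ((h2.of_mulEquiv e₁).of_mulEquiv e₂).of_mulEquiv e₃
  · intro i j hij
    fin_cases i <;> fin_cases j
    · exact absurd rfl hij
    · exact hN.free_pairQuotient 0 1 (by decide)
    · exact h02
    · exact hN.free_pairQuotient 1 0 (by decide)
    · exact absurd rfl hij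
    · exact h12
    · exact symm _ _ h02
    · exact symm _ _ h12
    · exact absurd rfl hij

/-! ## Under item 15157, every product-congruent `ρ` qualifies -/

/-- **Ghost anatomy (from item stmt-15157).**  Assume `HeegaardPairFreenessDetection`.  Then for every product-congruent
`ρ ∈ Aut S_{3+3m}` the twisted triple `T_ρ` is a `(3+3m; m+1)` group trisection of its own glued group: the two twisted
pairs are shadow-standard (witness `x_M`), so have the finite quotients of `F_{m+1}` (P1), so are free of rank `m+1`
(15157), and `isGroupTrisection_twisted_self` applies. [folklore] -/
theorem ghostAnatomy_of_item (hF : HeegaardPairFreenessDetection) (m : ℕ)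
    (ρ : SurfaceGroup (3 + 3 * m) ≃* SurfaceGroup (3 + 3 * m))
    (hρ : ∀ M : Subgroup (SurfaceGroup (3 + 3 * m)), M.Characteristic → M.FiniteIndex →
      ∃ x c : SurfaceGroup (3 + 3 * m) ≃* SurfaceGroup (3 + 3 * m),
        (s4Kernels.stabilizeIter m 0).map x.toMonoidHom = s4Kernels.stabilizeIter m 0 ∧
        (s4Kernels.stabilizeIter m 1).map x.toMonoidHom = s4Kernels.stabilizeIter m 1 ∧
        (s4Kernels.stabilizeIter m 2).map c.toMonoidHom = s4Kernels.stabilizeIter m 2 ∧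
        ∀ s, ρ s * (x (c s))⁻¹ ∈ M) :
    IsGroupTrisection (3 + 3 * m) (m + 1)
      (TrisectionKernels.tripleQuotient
        (![s4Kernels.stabilizeIter m 0, s4Kernels.stabilizeIter m 1, (s4Kernels.stabilizeIter m 2).map ρ.toMonoidHom] :
          TrisectionKernels (3 + 3 * m)))
      (![s4Kernels.stabilizeIter m 0, s4Kernels.stabilizeIter m 1, (s4Kernels.stabilizeIter m 2).map ρ.toMonoidHom] :
        TrisectionKernels (3 + 3 * m)) := by
  -- shadow-standardness of the two pairs `(N_i, ρN₂)`, `i = 0, 1` (witness `x_M`)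
  have hshadow : ∀ i : Fin 3, i ≠ 2 → ∀ M : Subgroup (SurfaceGroup (3 + 3 * m)), M.Characteristic → M.FiniteIndex →
      ∃ a : SurfaceGroup (3 + 3 * m) ≃* SurfaceGroup (3 + 3 * m),
        (s4Kernels.stabilizeIter m i ⊔ M).map a.toMonoidHom = s4Kernels.stabilizeIter m i ⊔ M ∧
        (s4Kernels.stabilizeIter m 2 ⊔ M).map a.toMonoidHom = (s4Kernels.stabilizeIter m 2).map ρ.toMonoidHom ⊔ M := by
    intro i hi M hM hFi
    obtain ⟨x, c, hx0, hx1, hc, hs⟩ := hρ M hM hFi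
    have hNi : (s4Kernels.stabilizeIter m i).map x.toMonoidHom = s4Kernels.stabilizeIter m i := by
      fin_cases i
      · exact hx0
      · exact hx1
      · exact absurd rfl hi
    refine ⟨x, ?_, ?_⟩
    · rw [Subgroup.map_sup, map_eq_of_characteristic x hM, hNi]
    · rw [Subgroup.map_sup, map_eq_of_characteristic x hM, map_sup_eq_of_congr hs (s4Kernels.stabilizeIter m 2), hc]
  have hfree : ∀ i : Fin 3, i ≠ 2 → IsFreeOfRank (SurfaceGroup (3 + 3 * m) ⧸ normalClosure
      ((s4Kernels.stabilizeIter m i : Set (SurfaceGroup (3 + 3 * m))) ∪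
        ((s4Kernels.stabilizeIter m 2).map ρ.toMonoidHom : Subgroup (SurfaceGroup (3 + 3 * m))))) (m + 1) :=
    fun i hi => stub_profiniteFreenessDetection_of_fact hF m i hi ρ
      (stub_pairShadowFiniteQuotients m i hi ρ (hshadow i hi))
  exact isGroupTrisection_twisted_self (hfree 0 (by decide)) (hfree 1 (by decide))

/-! ## The glued group: `T_ρ.tripleQuotient ≃* S ⧸ (N₀ ⊔ N₁ ⊔ ρN₂)` -/

/-- The normal closure of `N₀ ∪ N₁ ∪ ρN₂` is the join `N₀ ⊔ N₁ ⊔ ρN₂` (all three are normal). [folklore] -/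
theorem normalClosure_iUnion_twisted {m : ℕ} (ρ : SurfaceGroup (3 + 3 * m) ≃* SurfaceGroup (3 + 3 * m)) :
    normalClosure (⋃ i, ((![s4Kernels.stabilizeIter m 0, s4Kernels.stabilizeIter m 1,
        (s4Kernels.stabilizeIter m 2).map ρ.toMonoidHom] : TrisectionKernels (3 + 3 * m)) i :
          Set (SurfaceGroup (3 + 3 * m)))) =
      s4Kernels.stabilizeIter m 0 ⊔ s4Kernels.stabilizeIter m 1 ⊔ (s4Kernels.stabilizeIter m 2).map ρ.toMonoidHom := by
  haveI h0n : (s4Kernels.stabilizeIter m 0).Normal := stabilizeIter_normal m 0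
  haveI h1n : (s4Kernels.stabilizeIter m 1).Normal := stabilizeIter_normal m 1
  haveI h2n : ((s4Kernels.stabilizeIter m 2).map ρ.toMonoidHom).Normal := map_stabilizeIter_normal m 2 ρ
  apply le_antisymm
  · refine normalClosure_le_normal (Set.iUnion_subset fun i => ?_)
    fin_cases i
    · exact fun s hs => mem_sup_left (mem_sup_left hs)
    · exact fun s hs => mem_sup_left (mem_sup_right hs)
    · exact fun s hs => mem_sup_right hs
  · refine sup_le (sup_le ?_ ?_) ?_
    · exact fun s hs => subset_normalClosure (Set.mem_iUnion.2 ⟨0, hs⟩)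
    · exact fun s hs => subset_normalClosure (Set.mem_iUnion.2 ⟨1, hs⟩)
    · exact fun s hs => subset_normalClosure (Set.mem_iUnion.2 ⟨2, hs⟩)

/-- The join `N₀ ⊔ N₁ ⊔ ρN₂` is normal. [folklore] -/
theorem tripleJoin_twisted_normal {m : ℕ} (ρ : SurfaceGroup (3 + 3 * m) ≃* SurfaceGroup (3 + 3 * m)) :
    (s4Kernels.stabilizeIter m 0 ⊔ s4Kernels.stabilizeIter m 1 ⊔ (s4Kernels.stabilizeIter m 2).map ρ.toMonoidHom).Normal := by
  rw [← normalClosure_iUnion_twisted ρ]; infer_instance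

/-- **The glued group.** The triple quotient of `T_ρ` is `G_ρ = S ⧸ (N₀ ⊔ N₁ ⊔ ρN₂)` (as groups, for any `Normal`
instance on the join, e.g. `tripleJoin_twisted_normal`). [folklore] -/
theorem nonempty_tripleQuotient_twisted_equiv {m : ℕ} (ρ : SurfaceGroup (3 + 3 * m) ≃* SurfaceGroup (3 + 3 * m))
    [(s4Kernels.stabilizeIter m 0 ⊔ s4Kernels.stabilizeIter m 1 ⊔ (s4Kernels.stabilizeIter m 2).map ρ.toMonoidHom).Normal] :
    Nonempty (TrisectionKernels.tripleQuotient
        (![s4Kernels.stabilizeIter m 0, s4Kernels.stabilizeIter m 1, (s4Kernels.stabilizeIter m 2).map ρ.toMonoidHom] :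
          TrisectionKernels (3 + 3 * m)) ≃*
      SurfaceGroup (3 + 3 * m) ⧸
        (s4Kernels.stabilizeIter m 0 ⊔ s4Kernels.stabilizeIter m 1 ⊔ (s4Kernels.stabilizeIter m 2).map ρ.toMonoidHom)) :=
  ⟨QuotientGroup.quotientMulEquivOfEq (normalClosure_iUnion_twisted ρ)⟩

/-! ## The dichotomy for the glued group of a fine limit -/

/-- **Fine limits are balanced group trisections of `1` or of a Kervaire ghost (from item 15157).**  Assume
`HeegaardPairFreenessDetection`.  For every product-congruent `ρ ∈ Aut S_{3+3m}`: `T_ρ` is a `(3+3m; m+1)` group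
trisection of its glued group (`≃* S ⧸ (N₀ ⊔ N₁ ⊔ ρN₂)`, `nonempty_tripleQuotient_twisted_equiv`), and EITHER `N₀ ⊔ N₁ ⊔ ρN₂ = ⊤` (`G_ρ = 1`: a trisection of the trivial group)
OR `G_ρ` is infinite and every homomorphism from `S` to a finite group killing `N₀ ⊔ N₁ ⊔ ρN₂` is trivial.  So a
counterexample to "no fine ghosts" (equivalently, modulo items 15157 ∧ 14595 ∧ 14592, to the crux) is a balanced group
trisection of an infinite group without non-trivial finite quotients. [folklore] -/
theorem ghost_dichotomy_of_item (hF : HeegaardPairFreenessDetection) (m : ℕ)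
    (ρ : SurfaceGroup (3 + 3 * m) ≃* SurfaceGroup (3 + 3 * m))
    (hρ : ∀ M : Subgroup (SurfaceGroup (3 + 3 * m)), M.Characteristic → M.FiniteIndex →
      ∃ x c : SurfaceGroup (3 + 3 * m) ≃* SurfaceGroup (3 + 3 * m),
        (s4Kernels.stabilizeIter m 0).map x.toMonoidHom = s4Kernels.stabilizeIter m 0 ∧
        (s4Kernels.stabilizeIter m 1).map x.toMonoidHom = s4Kernels.stabilizeIter m 1 ∧
        (s4Kernels.stabilizeIter m 2).map c.toMonoidHom = s4Kernels.stabilizeIter m 2 ∧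
        ∀ s, ρ s * (x (c s))⁻¹ ∈ M) :
    IsGroupTrisection (3 + 3 * m) (m + 1)
        (TrisectionKernels.tripleQuotient
          (![s4Kernels.stabilizeIter m 0, s4Kernels.stabilizeIter m 1, (s4Kernels.stabilizeIter m 2).map ρ.toMonoidHom] :
            TrisectionKernels (3 + 3 * m)))
        (![s4Kernels.stabilizeIter m 0, s4Kernels.stabilizeIter m 1, (s4Kernels.stabilizeIter m 2).map ρ.toMonoidHom] :
          TrisectionKernels (3 + 3 * m)) ∧
      (s4Kernels.stabilizeIter m 0 ⊔ s4Kernels.stabilizeIter m 1 ⊔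
          (s4Kernels.stabilizeIter m 2).map ρ.toMonoidHom = ⊤ ∨
        (Infinite (SurfaceGroup (3 + 3 * m) ⧸ (s4Kernels.stabilizeIter m 0 ⊔ s4Kernels.stabilizeIter m 1 ⊔
            (s4Kernels.stabilizeIter m 2).map ρ.toMonoidHom)) ∧
          ∀ (Q : Type) [Group Q] [Finite Q] (f : SurfaceGroup (3 + 3 * m) →* Q),
            s4Kernels.stabilizeIter m 0 ⊔ s4Kernels.stabilizeIter m 1 ⊔
                (s4Kernels.stabilizeIter m 2).map ρ.toMonoidHom ≤ f.ker →
              ∀ s, f s = 1)) := by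
  refine ⟨ghostAnatomy_of_item hF m ρ hρ, ?_⟩
  · -- the landed dichotomy, re-derived: finite glued group ⇒ trivial (cofinality + level collapse)
    by_cases htop : s4Kernels.stabilizeIter m 0 ⊔ s4Kernels.stabilizeIter m 1 ⊔
        (s4Kernels.stabilizeIter m 2).map ρ.toMonoidHom = ⊤
    · exact Or.inl htop
    · refine Or.inr ⟨?_, fun Q _ _ f hf s => hom_trivial_of_productCongruent hρ f hf s⟩
      rw [← not_finite_iff_infinite]
      intro hfin
      haveI : (s4Kernels.stabilizeIter m 0 ⊔ s4Kernels.stabilizeIter m 1 ⊔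
          (s4Kernels.stabilizeIter m 2).map ρ.toMonoidHom).FiniteIndex := Subgroup.finiteIndex_of_finite_quotient
      obtain ⟨M, hM, hFi, hle⟩ := exists_characteristic_le
        (s4Kernels.stabilizeIter m 0 ⊔ s4Kernels.stabilizeIter m 1 ⊔ (s4Kernels.stabilizeIter m 2).map ρ.toMonoidHom)
      have h := tripleJoin_sup_eq_top_of_productCongruent hρ M hM hFi
      rw [sup_eq_left.2 hle] at h
      exact htop h

/-! ## Registered stub of skeleton v2 (signature verbatim as registered on stmt-SmoothPoincare4-14596) -/

/-- **Registered P3-helper stub `stub_ghostAnatomy` of line `pair-rigidity-retraction`:** under item 15157 every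
product-congruent `ρ` makes `T_ρ` a `(3+3m; m+1)` group trisection of its own glued group; `= ghostAnatomy_of_item`.
[folklore] -/
theorem stub_ghostAnatomy :
    HeegaardPairFreenessDetection →
      ∀ (m : ℕ) (ρ : SurfaceGroup (3 + 3 * m) ≃* SurfaceGroup (3 + 3 * m)),
        (∀ M : Subgroup (SurfaceGroup (3 + 3 * m)), M.Characteristic → M.FiniteIndex →
          ∃ x c : SurfaceGroup (3 + 3 * m) ≃* SurfaceGroup (3 + 3 * m),
            (s4Kernels.stabilizeIter m 0).map x.toMonoidHom = s4Kernels.stabilizeIter m 0 ∧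
            (s4Kernels.stabilizeIter m 1).map x.toMonoidHom = s4Kernels.stabilizeIter m 1 ∧
            (s4Kernels.stabilizeIter m 2).map c.toMonoidHom = s4Kernels.stabilizeIter m 2 ∧
            ∀ s, ρ s * (x (c s))⁻¹ ∈ M) →
        IsGroupTrisection (3 + 3 * m) (m + 1)
          (TrisectionKernels.tripleQuotient
            (![s4Kernels.stabilizeIter m 0, s4Kernels.stabilizeIter m 1, (s4Kernels.stabilizeIter m 2).map ρ.toMonoidHom] :
              TrisectionKernels (3 + 3 * m)))
          (![s4Kernels.stabilizeIter m 0, s4Kernels.stabilizeIter m 1, (s4Kernels.stabilizeIter m 2).map ρ.toMonoidHom] :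
            TrisectionKernels (3 + 3 * m)) :=
  fun hF m ρ hρ => ghostAnatomy_of_item hF m ρ hρ

end Summit.SmoothPoincare4.SmoothPoincare4.Theorems.HeegaardHandlebodyCongruenceClosed.PairRigidityRetraction

end
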